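import Mathlib
import Summits.Ventures.PercRepro2.SwOutAll
import Summits.Ventures.PercRepro2.SwOutArmFlip
import Summits.Ventures.PercRepro2.SwOutJunctionsSplit
import Summits.Ventures.PercRepro2.SwOutAdjSplit
import Summits.Ventures.PercRepro2.SwOutAdjFine

/-!
# The matched set of a configuration for a set of junctions with internal edges (blind cell
PercRepro2, night-4 g11, 2026-08-25; proofs/NIGHT4-G11.md §5(5))

A subset `S ⊆ J` is **good** for `η` if every non-internal edge at `S` is edge-matched; the
**matched set** `aSet` is the union of the good sets — the greatest good set.  Every core junction
lies in it (`mem_aSet_of_core`); the configuration is `aSet`-fine (`afine_aSet`) and core-free in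
the graph split at `aSet` (`coreFree_split_aSet`).  Edge-matchedness of an edge between unsplit
vertices transfers to the split graph (`edgeMatched_splitS_iff`) and comes back along an arm flip
(`edgeMatched_of_edgeMatched_flip`, in any core-free graph).
-/

namespace Summit.Ventures.PercRepro2

namespace LocRows

open Hull

variable {V : Type*} {E : Type*} [Fintype E] [DecidableEq E]

open scoped Classical

section ASet

variable (ends : E → Sym2 V) (J : Set V) (h : V)

/-- A **good** set for `η`: a subset of `J` all of whose non-internal edges are edge-matched. -/
def Good (η : Config E) (S : Set V) : Prop :=
  S ⊆ J ∧ ∀ u ∈ S, ∀ e, u ∈ ends e → ¬ Internal ends S e → EdgeMatched ends h η e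

/-- The **matched set**: the union of the good sets (the greatest good set). -/
def aSet (η : Config E) : Set V := {u | ∃ S, Good ends J h η S ∧ u ∈ S}

variable {ends J h}

omit [Fintype E] [DecidableEq E] in
/-- Internality is monotone in the set. -/
lemma Internal.mono {S S' : Set V} (hS : S ⊆ S') {e : E} (hi : Internal ends S e) :
    Internal ends S' e := fun x hx => hS (hi x hx)

omit [Fintype E] [DecidableEq E] in
/-- A good set lies in the matched set. -/
lemma subset_aSet_of_good {η : Config E} {S : Set V} (hS : Good ends J h η S) :
    S ⊆ aSet ends J h η := fun _ hu => ⟨S, hS, hu⟩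

omit [Fintype E] [DecidableEq E] in
/-- The matched set lies in `J`. -/
lemma aSet_subset {η : Config E} : aSet ends J h η ⊆ J := by
  rintro u ⟨S, hS, hu⟩
  exact hS.1 hu

omit [Fintype E] [DecidableEq E] in
/-- **The matched set is good.** -/
theorem good_aSet {η : Config E} : Good ends J h η (aSet ends J h η) := by
  refine ⟨aSet_subset, ?_⟩
  rintro u ⟨S, hS, huS⟩ e hue hi
  exact hS.2 u huS e hue fun hi' => hi (hi'.mono (subset_aSet_of_good hS))

omit [Fintype E] [DecidableEq E] in
/-- Every non-internal edge at the matched set is edge-matched. -/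
lemma edgeMatched_of_mem_aSet {η : Config E} {u : V} (hu : u ∈ aSet ends J h η) {e : E}
    (hue : u ∈ ends e) (hi : ¬ Internal ends (aSet ends J h η) e) : EdgeMatched ends h η e :=
  good_aSet.2 u hu e hue hi

omit [Fintype E] [DecidableEq E] in
/-- A vertex of `J` all of whose edges are edge-matched lies in the matched set. -/
lemma mem_aSet_of_edgeMatched {η : Config E} {u : V} (huJ : u ∈ J)
    (hm : ∀ e, u ∈ ends e → EdgeMatched ends h η e) : u ∈ aSet ends J h η :=
  subset_aSet_of_good ⟨Set.singleton_subset_iff.2 huJ, fun v hv e hve _ => by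
    rw [Set.mem_singleton_iff] at hv; subst hv; exact hm e hve⟩ rfl

omit [Fintype E] [DecidableEq E] in
/-- A core junction lies in the matched set. -/
lemma mem_aSet_of_core {η : Config E} {u : V} (huJ : u ∈ J) (hT : u ∈ cluster ends η h)
    (hTp : u ∈ cluster ends (blue η) h) : u ∈ aSet ends J h η :=
  mem_aSet_of_edgeMatched huJ fun _ he => edgeMatched_of_core hT hTp he

omit [Fintype E] [DecidableEq E] in
/-- A junction outside the matched set is not a core. -/
lemma not_core_of_notMem_aSet {η : Config E} {u : V} (huJ : u ∈ J) (hu : u ∉ aSet ends J h η)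
    (hT : u ∈ cluster ends η h) : u ∉ cluster ends (blue η) h :=
  fun hTp => hu (mem_aSet_of_core huJ hT hTp)

omit [Fintype E] [DecidableEq E] in
/-- **The configuration is fine for its matched set** (`h ∉ J`, every neighbour `p ≠ h` of a
junction adjacent to `h`, the cores in `{h} ∪ J`). -/
theorem afine_aSet (hhJ : h ∉ J)
    (hadj : ∀ u ∈ J, ∀ e (he : u ∈ ends e), Sym2.Mem.other he ≠ h →
      ∃ e', ends e' = s(Sym2.Mem.other he, h))
    {η : Config E}
    (hcore : ∀ x, x ∈ cluster ends η h → x ∈ cluster ends (blue η) h → x = h ∨ x ∈ J) :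
    AFine ends (aSet ends J h η) h η :=
  afine_of_edgeMatched (fun h' => hhJ (aSet_subset h')) (fun u hu => hadj u (aSet_subset hu))
    (fun x hx hx' => (hcore x hx hx').imp_right fun hxJ => mem_aSet_of_core hxJ hx hx')
    (fun _ hu _ hue hi => edgeMatched_of_mem_aSet hu hue hi)

omit [Fintype E] [DecidableEq E] in
/-- **The configuration is core-free in the graph split at its matched set** (`h ∉ J`, the cores
in `{h} ∪ J`). -/
theorem coreFree_split_aSet (hhJ : h ∉ J) {η : Config E}
    (hcore : ∀ x, x ∈ cluster ends η h → x ∈ cluster ends (blue η) h → x = h ∨ x ∈ J) :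
    CoreFree (splitEndsS ends (aSet ends J h η)) η (Sum.inl h) := by
  rintro (x | e) hxT hxTp
  · have h1 : x ∈ cluster ends η h := conn_of_conn_splitS_inl' hxT
    have h2 : x ∈ cluster ends (blue η) h := conn_of_conn_splitS_inl' hxTp
    rcases hcore x h1 h2 with rfl | hxJ
    · rfl
    · have hxM : x ∈ aSet ends J h η := mem_aSet_of_core hxJ h1 h2
      exact absurd hxT (inl_S_notMem_cluster_splitS hxM (fun h' => hhJ (h' ▸ hxJ)))
  · exfalso
    obtain ⟨_, _, _, _, h1, _⟩ := conn_of_conn_splitS_inr' hxT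
    obtain ⟨_, _, _, _, h2, _⟩ := conn_of_conn_splitS_inr' hxTp
    rw [blue_eq_true_iff] at h2
    rw [h1] at h2
    exact absurd h2 (by simp)

end ASet

/-! ## Edge-matchedness between unsplit vertices, through the split -/

section Transfer

variable {ends : E → Sym2 V} {S : Set V} {h : V}

omit [Fintype E] [DecidableEq E] in
/-- For an edge with no end in `S` and an `S`-fine configuration, edge-matchedness in the graph
and in the split graph agree (`h ∉ S`). -/
theorem edgeMatched_splitS_iff (hhS : h ∉ S) {η : Config E} (hf : AFine ends S h η) {e : E}
    (he : ∀ z ∈ ends e, z ∉ S) :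
    EdgeMatched (splitEndsS ends S) (Sum.inl h) η e ↔ EdgeMatched ends h η e := by
  obtain ⟨x, y, hxy⟩ := exists_pairS (ends e)
  have hx : x ∉ S := he x (by rw [hxy]; exact Sym2.mem_mk_left _ _)
  have hy : y ∉ S := he y (by rw [hxy]; exact Sym2.mem_mk_right _ _)
  have hsplit := splitEndsS_of_notMem hxy hx hy
  have key : ∀ η' : Config E, AFine ends S h η' →
      ((∀ z' ∈ splitEndsS ends S e, z' ∈ cluster (splitEndsS ends S) η' (Sum.inl h)) ↔
        ∀ z ∈ ends e, z ∈ cluster ends η' h) := by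
    intro η' hf'
    rw [hsplit, hxy]
    simp only [Sym2.mem_iff, forall_eq_or_imp, forall_eq]
    rw [inl_mem_cluster_splitS_iff_of_afine hhS hf' hx, inl_mem_cluster_splitS_iff_of_afine hhS hf' hy]
  simp only [EdgeMatched]
  rw [key η hf, key (blue η) (afine_blue_iff.2 hf)]

end Transfer

/-! ## Edge-matchedness comes back along an arm flip -/

section FlipBack

variable {ends : E → Sym2 V} {h : V}

omit [Fintype E] [DecidableEq E] in
/-- Edge-matchedness comes back along an arm flip of a core-free configuration. -/
theorem edgeMatched_of_edgeMatched_flip {ζ : Config E} {P : Set V} (hc : CoreFree ends ζ h)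
    (hP : ArmClosed ends ζ h P) {e : E} (hm : EdgeMatched ends h (flip ends P ζ) e) :
    EdgeMatched ends h ζ e := by
  have hT := cluster_flip_of_armClosed hc hP
  have hTp := cluster_blue_flip_of_armClosed hc hP
  obtain ⟨hm1, hm2⟩ := hm
  rw [hT] at hm1
  rw [hTp] at hm2
  obtain ⟨x, y, hxy⟩ := exists_pairS (ends e)
  have hclosed : ∀ z w, ends e = s(z, w) → z ∈ P → w ∈ hull ends ζ h → w ≠ h → w ∈ P :=
    fun z w hzw hz hw hwh => hP.closed e z w hzw hz hw hwh
  by_cases hte : e ∈ touches ends P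
  · constructor
    · intro hred
      have h1 : flip ends P ζ e = false := by rw [flip_apply_of_mem hte, hred]; rfl
      have hz := hm2 h1
      -- both ends in `(T' ∖ P) ∪ (P ∩ T)`; one end is in `P` and so in `T`; the other follows
      have hte' : x ∈ P ∨ y ∈ P := (mem_touches_iff_of_ends hxy).1 hte
      have hxm := hz x (by rw [hxy]; exact Sym2.mem_mk_left _ _)
      have hym := hz y (by rw [hxy]; exact Sym2.mem_mk_right _ _)
      intro z hzz
      rw [hxy, Sym2.mem_iff] at hzz
      -- an end in `P` lies in `T`; an end outside `P` lies in `T' ∖ P`, hence in the hull, hence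
      -- (arm-closedness) is `h` or in `P` — the former is in `T`, the latter contradicts
      have hend : ∀ a b, ends e = s(a, b) → a ∈ P → b ∈ (cluster ends (blue ζ) h \ P) ∪
          (P ∩ cluster ends ζ h) → a ∈ cluster ends ζ h → b ∈ cluster ends ζ h := by
        intro a b hab haP hb haT
        rcases hb with ⟨hbTp, hbP⟩ | ⟨_, hbT⟩
        · by_cases hbh : b = h
          · rw [hbh]; exact mem_cluster_self _ _ _
          · exact absurd (hclosed a b hab haP (Or.inr hbTp) hbh) hbP
        · exact hbT
      rcases hte' with hxP | hyP
      · have hxT : x ∈ cluster ends ζ h := by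
          rcases hxm with ⟨_, hxP'⟩ | ⟨_, hxT⟩
          · exact absurd hxP hxP'
          · exact hxT
        rcases hzz with rfl | rfl
        · exact hxT
        · exact hend x z hxy hxP hym hxT
      · have hyT : y ∈ cluster ends ζ h := by
          rcases hym with ⟨_, hyP'⟩ | ⟨_, hyT⟩
          · exact absurd hyP hyP'
          · exact hyT
        rcases hzz with rfl | rfl
        · exact hend y z (ends_swap hxy) hyP hxm hyT
        · exact hyT
    · intro hblue
      have h1 : flip ends P ζ e = true := by rw [flip_apply_of_mem hte, hblue]; rfl
      have hz := hm1 h1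
      have hte' : x ∈ P ∨ y ∈ P := (mem_touches_iff_of_ends hxy).1 hte
      have hxm := hz x (by rw [hxy]; exact Sym2.mem_mk_left _ _)
      have hym := hz y (by rw [hxy]; exact Sym2.mem_mk_right _ _)
      intro z hzz
      rw [hxy, Sym2.mem_iff] at hzz
      have hend : ∀ a b, ends e = s(a, b) → a ∈ P → b ∈ (cluster ends ζ h \ P) ∪
          (P ∩ cluster ends (blue ζ) h) → a ∈ cluster ends (blue ζ) h →
          b ∈ cluster ends (blue ζ) h := by
        intro a b hab haP hb haT
        rcases hb with ⟨hbT, hbP⟩ | ⟨_, hbTp⟩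
        · by_cases hbh : b = h
          · rw [hbh]; exact mem_cluster_self _ _ _
          · exact absurd (hclosed a b hab haP (Or.inl hbT) hbh) hbP
        · exact hbTp
      rcases hte' with hxP | hyP
      · have hxTp : x ∈ cluster ends (blue ζ) h := by
          rcases hxm with ⟨_, hxP'⟩ | ⟨_, hxTp⟩
          · exact absurd hxP hxP'
          · exact hxTp
        rcases hzz with rfl | rfl
        · exact hxTp
        · exact hend x z hxy hxP hym hxTp
      · have hyTp : y ∈ cluster ends (blue ζ) h := by
          rcases hym with ⟨_, hyP'⟩ | ⟨_, hyTp⟩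
          · exact absurd hyP hyP'
          · exact hyTp
        rcases hzz with rfl | rfl
        · exact hend y z (ends_swap hxy) hyP hxm hyTp
        · exact hyTp
  · have hxP : x ∉ P := fun h' => hte ⟨x, h', y, hxy⟩
    have hyP : y ∉ P := fun h' => hte ⟨y, h', x, ends_swap hxy⟩
    constructor
    · intro hred
      have h1 : flip ends P ζ e = true := by rw [flip_apply_of_notMem hte]; exact hred
      intro z hzz
      have hzP : z ∉ P := by
        rw [hxy, Sym2.mem_iff] at hzz
        rcases hzz with rfl | rfl
        · exact hxP
        · exact hyP
      rcases hm1 h1 z hzz with ⟨hzT, _⟩ | ⟨hzP', _⟩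
      · exact hzT
      · exact absurd hzP' hzP
    · intro hblue
      have h1 : flip ends P ζ e = false := by rw [flip_apply_of_notMem hte]; exact hblue
      intro z hzz
      have hzP : z ∉ P := by
        rw [hxy, Sym2.mem_iff] at hzz
        rcases hzz with rfl | rfl
        · exact hxP
        · exact hyP
      rcases hm2 h1 z hzz with ⟨hzTp, _⟩ | ⟨hzP', _⟩
      · exact hzTp
      · exact absurd hzP' hzP

end FlipBack

end LocRows

end Summit.Ventures.PercRepro2
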